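/-
Copyright (c) 2026 the pub-hodgecm-mathlib formalisation cell (harness21).  Prover seat hodgecm-mathlib-K2E1-p14 (g4), Track B ∕ K2-LIT, h413 = `stmt-HodgeConjecture-24833`,
R90-TF section S8 «ContSpec-n½», socket (E) `sock_S8_res_exhaustion_le_closure` (B ED. 7 :276) via ★ `res_exhaustion_le_closure_of_record`: THE ARCHIMEDEAN-LEVEL BRIDGE of the (N₃)
row — the per-`K_∞`-type letter `hτ` of ★ `hNblk_of_kTypes` for a ONE-DIMENSIONAL `K_∞`-type, FROM ★ `resG_isotypic_le_orthogonal_residueSpan_of_lineModel` (D5′ at a level datum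
`(K′, ω)` with archimedean component), by Hilbert-space algebra over four named letters; the type-match letter discharged at the `Kad` level `closure⟨ι_∞(K_∞) ∪ ι_f(Kf)⟩`
(S8 dealer R90-CS-plan (g3) S8-R194 (4); census `K2/K2E1-p14/g4/CENSUS-E5-ArchLevelBridge.K2E1-p14-g4.md`).
-/
import Summits.HodgeConjecture.HodgeConjecture.Theorems.R90S8ResExhaustionLeClosureOfLettersU3     -- ★ p863683 (this seat): `restrict_archInfUnitaryOne_apply_mem_resGBlock` (the blocks of record are `K_∞`-stable); brings ★ G-DEFS, ★ K-type glue imports (`starProjection_isotypicComponent_mem'`)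
import Summits.HodgeConjecture.HodgeConjecture.Theorems.K2E1CuspidalSpectrumUnitaryDefs           -- ★ `residualSubspace`
import HarnessLib

/-!
# S8 (E) road — `R90S8ResGIsotypicArchLevelBridgeU3`: the per-type letter `hτ` of the (N₃) glue for a ONE-DIMENSIONAL `K_∞`-type, from D5′ at an archimedean level datum `(K′, ω)` —
# Hilbert-space bridge over four named letters, the type match discharged at `Kad(Kf) = closure⟨ι_∞(K_∞) ∪ ι_f(Kf)⟩`

Track B ∕ K2-LIT, crux h413 = `stmt-HodgeConjecture-24833`, route of record `HCCMUnconditional`; cell `hodgecm-mathlib`, R90-TF programme, section S8 «ContSpec-n½», socket (E)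
(B ED. 7 :276).  ROAD: (E) = ★ `res_exhaustion_le_closure_of_record` modulo … (N₃) = ★ `hNblk_of_kTypes` (per-`K_∞`-type letters `hτ`, glued by Peter–Weyl) — and for a 1-dimensional type
`τ` (character `χ_∞` of `K_∞ = U(J₃)(L⁺⊗ℝ) ∩ U(1⊗1)`) the letter `hτ` comes, through THIS FILE, from ★ `resG_isotypic_le_orthogonal_residueSpan_of_lineModel` (p863747 §2: D5′ at ANY level
datum `(K′, ω)`, here one with archimedean component carrying `χ_∞`).  THEOREMS ONLY (no `def`, no `instance`, no `notation`, no named-fact hypothesis, no `sorry`; default heartbeats);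
lane `--supports stmt-HodgeConjecture-24833 --as helper` (count-neutral).  CLOSES NO SOCKET.  (The K-TYPE CURRENCY FLAG, booked S8-R189: types of dimension `> 1` need the
χ_τ-idempotent edition of D5′, reserved `R90S8ResGIsotypicTauIdempotentModelU3`, not this bridge.)

THE MATHEMATICS ([DeitmarEchterhoff2014, Prop. 7.3.3, §7.3]; [MoeglinWaldspurger1995, II.1.1, VI.2]; [BorelJacquet1979, §4.1, §4.6]).  Data: the block `Sc = Sc(ι_f Kf, 1; χ₁, χ₂)`, its
residue space `A`, a 1-dimensional `K_∞`-type piece `N_τ` (isotypic component in `L²` of `ρ = R ∘ ι_∞`), a level datum `(K′, ω)` with its block `Sc′ = resGBlock L μ K′ ω χ₁ χ₂` and residue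
space `A′ ≤ A`.  TARGET `hτ`: for irreducible residual `W`, `W ∩ Fix(ι_f Kf) ∩ N_τ ⟂ Sc ∩ Aᗮ`.  Take `w` in the former, `x` in the latter, `P_τ` the orthogonal projection onto `N_τ`:
`⟪x, w⟫ = ⟪P_τ x, w⟫` (`x − P_τ x ⟂ N_τ ∋ w`).  `P_τ` maps every CLOSED `K_∞`-STABLE subspace into itself (★ `starProjection_isotypicComponent_mem'`): `Sc` is such (★ `isClosed_resGBlock`,
★ `restrict_archInfUnitaryOne_apply_mem_resGBlock`), and so is `Aᗮ` when `A` is `K_∞`-stable (unitarity, §0) — letter (h2).  Hence `P_τ x ∈ Sc ∩ N_τ ∩ Aᗮ ⊆ Sc′ ∩ A′ᗮ` by the ISOTYPIC-CUT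
letter (h3) `Sc ⊓ N_τ ≤ Sc′` («the `χ_∞`-part of the full-level block is the `(K′, ω)`-block»: `P_τ θ_{f,φ} = θ_{f,P_τ φ}`, E1) and (h4) `A′ ≤ A`; and `w ∈ W ∩ Fix_{K′}(ω)` by the TYPE-MATCH
letter (h1) `Fix(ι_f Kf) ⊓ N_τ ≤ Fix_{K′}(ω)`; so `⟪P_τ x, w⟫ = 0` by D5′'s output (h5) `W ⊓ Fix_{K′}(ω) ≤ (Sc′ ⊓ A′ᗮ)ᗮ` (★ p863747 §2, BY NAME).  At the level `K′ := Kad(Kf) = closure⟨ι_∞(K_∞) ∪ ι_f(Kf)⟩`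
with `ω(ι_∞ k) = χ_∞(k)`, `ω(ι_f u) = 1`, (h1) HOLDS whenever `N_τ` lies in the `χ_∞`-eigenspace of `ρ` (§2, induction over the closure: generators by `χ_∞` resp. `Fix`, products and inverses
by multiplicativity of `R` and `ω`).
* §0 GENERIC (complex inner-product spaces): `orthogonal_stable_of_stable` (unitary family), **`inf_le_orthogonal_of_isotypic_cut`** (the core: six subspaces, one projection).
* §1 **`hτ_of_archLevel`** — `U(J₃)`, κ OF RECORD, index of record `Kf`, ANY `(K′, ω)`: letters (h1)–(h5) ⊢ the `hτ` BYTES of ★ `hNblk_of_kTypes`.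
* §2 **`fixFin_inf_le_fix_kad`** — (h1) DISCHARGED at `Kad(Kf)` for a `χ_∞`-eigen piece; **`hτ_of_kadLevel`** = §1 ∘ §2 (letters (h2)(h3)(h4)(h5) + «`N_τ` is `χ_∞`-eigen»).
HONEST LABEL: HC_CM is proved only modulo the 7 printed citations (2 remaining named inputs: hLiu418 = `stmt-HodgeConjecture-24832`, h413 = `stmt-HodgeConjecture-24833`) until
rung 0 closes; REL ≠ ★ ≠ BUILT; this file asserts no named fact, is conditional on its visible letters, and closes no socket; count-neutral.

## References
* [DeitmarEchterhoff2014] A. Deitmar, S. Echterhoff, *Principles of Harmonic Analysis* (2nd ed., 2014), Prop. 7.3.3, §7.3.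
* [MoeglinWaldspurger1995] C. Mœglin, J.-L. Waldspurger, *Spectral Decomposition and Eisenstein Series* (1995), II.1.1, VI.2.
* [BorelJacquet1979] A. Borel, H. Jacquet, *Automorphic forms and automorphic representations*, PSPM 33.1 (1979), §4.1, §4.6.
-/

set_option autoImplicit false
set_option linter.dupNamespace false  -- the mandated namespace `…HodgeConjecture.HodgeConjecture.R90.S8` (LEAD #1 L1) repeats the summit's segment

noncomputable section

open MeasureTheory Filter Topology NumberField ContRepresentation Set
open scoped InnerProductSpace ENNReal NNReal
open Literature.NumberTheory.Automorphic Literature.NumberTheory.Automorphic.UnitaryGroup Literature.NumberTheory.GaloisRepresentations AdelicGroupData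
open Literature.NumberTheory.Automorphic.Arthur2013.Leaves.TECR
open Summit.HodgeConjecture.HodgeConjecture.Cruxes.H413.K2E1CuspidalSpectrumUnitary (residualSubspace)

namespace Summit.HodgeConjecture.HodgeConjecture.R90.S8

/-! ## §0 Generic Hilbert-space lemmas -/

section Generic

variable {H : Type*} [NormedAddCommGroup H] [InnerProductSpace ℂ H]

/-- **A unitary family preserving `A` preserves `Aᗮ`**: `⟪a, ρ(c) x⟫ = ⟪ρ(c⁻¹) a, x⟫ = 0`. [cite: DeitmarEchterhoff2014, §7.3] -/
theorem orthogonal_stable_of_stable [CompleteSpace H] {C : Type*} [Group C] {ρ : ContRepresentation ℂ C H} (hρ : ρ.IsUnitary) (A : Submodule ℂ H)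
    (hA : ∀ (c : C), ∀ v ∈ A, ρ c v ∈ A) (c : C) {x : H} (hx : x ∈ Aᗮ) : ρ c x ∈ Aᗮ := by
  rw [Submodule.mem_orthogonal] at hx ⊢
  intro a ha
  rw [← hρ.inner_map_map c⁻¹ a (ρ c x), ← mul_apply_eq_comp, ← map_mul ρ, inv_mul_cancel, map_one ρ, one_apply_eq_self]
  exact hx _ (hA c⁻¹ a ha)

/-- **THE CORE OF THE BRIDGE**: `N` a subspace with an orthogonal projection `P_N`, `Sc, A` (the block and its residues), `Sc′, A′` (the sub-block and its residues), `Wf, Wf′` (the two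
fixed-vector cuts of `W`).  If `P_N` preserves `Sc` and `Aᗮ`, `Sc ⊓ N ≤ Sc′`, `A′ ≤ A`, `Wf ⊓ N ≤ Wf′` and `Wf′ ⟂ Sc′ ⊓ A′ᗮ`, then `Wf ⊓ N ⟂ Sc ⊓ Aᗮ`:
`⟪x, w⟫ = ⟪P_N x, w⟫ + ⟪x − P_N x, w⟫ = 0 + 0`. [cite: DeitmarEchterhoff2014, Prop. 7.3.3] -/
theorem inf_le_orthogonal_of_isotypic_cut (N : Submodule ℂ H) [N.HasOrthogonalProjection] (Sc A Sc' A' Wf Wf' : Submodule ℂ H)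
    (hPSc : ∀ x ∈ Sc, N.starProjection x ∈ Sc) (hPA : ∀ x ∈ Aᗮ, N.starProjection x ∈ Aᗮ)
    (hcut : Sc ⊓ N ≤ Sc') (hA' : A' ≤ A) (hW : Wf ⊓ N ≤ Wf') (h5 : Wf' ≤ (Sc' ⊓ A'ᗮ)ᗮ) :
    Wf ⊓ N ≤ (Sc ⊓ Aᗮ)ᗮ := by
  rintro w ⟨hwW, hwN⟩
  rw [Submodule.mem_orthogonal]
  rintro x ⟨hxSc, hxA⟩
  have hw5 : w ∈ (Sc' ⊓ A'ᗮ)ᗮ := h5 (hW ⟨hwW, hwN⟩)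
  have hPx : N.starProjection x ∈ Sc' ⊓ A'ᗮ :=
    ⟨hcut ⟨hPSc x hxSc, Submodule.starProjection_apply_mem N x⟩, Submodule.orthogonal_le hA' (hPA x hxA)⟩
  have h1 : ⟪N.starProjection x, w⟫_ℂ = 0 := Submodule.inner_right_of_mem_orthogonal hPx hw5
  have h2 : ⟪x - N.starProjection x, w⟫_ℂ = 0 := by
    rw [inner_eq_zero_symm]
    exact Submodule.inner_right_of_mem_orthogonal hwN (Submodule.sub_starProjection_mem_orthogonal x)
  calc ⟪x, w⟫_ℂ = ⟪N.starProjection x + (x - N.starProjection x), w⟫_ℂ := by rw [add_sub_cancel]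
    _ = 0 := by rw [inner_add_left, h1, h2, add_zero]

end Generic

/-! ## §1 At `U(J₃)_{L∕L⁺}`: the per-type letter `hτ` from D5′ at an arbitrary level datum `(K′, ω)` -/

section Record

variable (L : Type) [Field L] [NumberField L] [IsCMField L]
  (μ : Measure (quasiSplit (↥(maximalRealSubfield L)) L (IsCMField.complexConj L) 3).automorphicQuotient) [(quasiSplit (↥(maximalRealSubfield L)) L (IsCMField.complexConj L) 3).IsAutomorphicMeasure μ]

/-- **THE ARCHIMEDEAN-LEVEL BRIDGE** — the `hτ Kf b τ` BYTES of ★ `hNblk_of_kTypes` (`W ⊓ (Fix(ι_f Kf) ⊓ N_τ) ≤ (Sc ⊓ Aᗮ)ᗮ` for every irreducible residual `W`) at the block of record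
`Sc = resGBlock L μ (ι_f Kf) 1 χ₁ χ₂` (`Kf` open `≤ K₀`, `χ₂` automorphic) FROM a level datum `(K′, ω)` and its block `Sc′ = resGBlock L μ K′ ω χ₁ χ₂`, modulo the letters: (h1) TYPE MATCH
`Fix(ι_f Kf) ⊓ N_τ ≤ Fix_{K′}(ω)`; (h2) `A` is `K_∞`-STABLE; (h3) ISOTYPIC CUT `Sc ⊓ N_τ ≤ Sc′` (E1); (h4) `A′ ≤ A`; (h5) D5′'s output at `(K′, ω, A′)` = ★ p863747 §2's conclusion bytes.  Proof: §0 core with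
`P_τ` preserving `Sc` (★ `starProjection_isotypicComponent_mem'`, ★ `isClosed_resGBlock`, ★ `restrict_archInfUnitaryOne_apply_mem_resGBlock`) and `Aᗮ` (§0 `orthogonal_stable_of_stable`).
[cite: DeitmarEchterhoff2014, Prop. 7.3.3] [cite: MoeglinWaldspurger1995, II.1.1, VI.2] [cite: BorelJacquet1979, §4.6] -/
theorem hτ_of_archLevel (𝔓 : (quasiSplit (↥(maximalRealSubfield L)) L (IsCMField.complexConj L) 3).ParabolicUnipotentData) (Kf : {Kf : Subgroup ↥(finAdelic (↥(maximalRealSubfield L)) L (IsCMField.complexConj L) 3 ((StdForm.antidiagonal 3).over L)) // IsOpen ((Kf : Subgroup ↥(finAdelic (↥(maximalRealSubfield L)) L (IsCMField.complexConj L) 3 ((StdForm.antidiagonal 3).over L))) : Set ↥(finAdelic (↥(maximalRealSubfield L)) L (IsCMField.complexConj L) 3 ((StdForm.antidiagonal 3).over L))) ∧ Kf ≤ ((((standardMaximalCompactGL 3 L).comap (adelicVal (↥(maximalRealSubfield L)) L (IsCMField.complexConj L) 3 ((StdForm.antidiagonal 3).over L)) : Subgroup (quasiSplit (↥(maximalRealSubfield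 L)) L (IsCMField.complexConj L) 3).Adelic)).comap (finAdelicToAdelic (↥(maximalRealSubfield L)) L (IsCMField.complexConj L) 3 ((StdForm.antidiagonal 3).over L)) : Subgroup ↥(finAdelic (↥(maximalRealSubfield L)) L (IsCMField.complexConj L) 3 ((StdForm.antidiagonal 3).over L)))})
    (χ₁ : HeckeCharacter L) {χ₂ : ↥(TorusDict.torus (IsCMField.complexConj L)) →ₜ* ℂˣ} (hχ₂ : TorusDict.IsAutomorphic (IsCMField.complexConj L) χ₂)
    (τ : {U : ClosedSubrep (((quasiSplit (↥(maximalRealSubfield L)) L (IsCMField.complexConj L) 3).rightRegular μ).restrict ((archToAdelic (↥(maximalRealSubfield L)) L (IsCMField.complexConj L) 3 ((StdForm.antidiagonal 3).over L)).comp (Subgroup.inclusion (inf_le_left : (UnitaryGroup.arch (↥(maximalRealSubfield L)) L (IsCMField.complexConj L) 3 ((StdForm.antidiagonal 3).over L) ⊓ unitaryGroupOfForm (conjMixed (↥(maximalRealSubfield L)) L (IsCMField.complexConj L)) 1) ≤ UnitaryGroup.arch (↥(maximalRealSubfield L)) L (IsCMField.complexConj L) 3 ((StdForm.antidiagonal 3).over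 L))))) // U.toContRep.IsTopIrreducible})
    (K' : Subgroup (quasiSplit (↥(maximalRealSubfield L)) L (IsCMField.complexConj L) 3).Adelic) (ω : ↥K' →* ℂ) (A A' : Submodule ℂ ((quasiSplit (↥(maximalRealSubfield L)) L (IsCMField.complexConj L) 3).L2 μ)) (hA'A : A' ≤ A)
    (hAstab : ∀ (k : ↥(UnitaryGroup.arch (↥(maximalRealSubfield L)) L (IsCMField.complexConj L) 3 ((StdForm.antidiagonal 3).over L) ⊓ unitaryGroupOfForm (conjMixed (↥(maximalRealSubfield L)) L (IsCMField.complexConj L)) 1)), ∀ v ∈ A, (((quasiSplit (↥(maximalRealSubfield L)) L (IsCMField.complexConj L) 3).rightRegular μ).restrict ((archToAdelic (↥(maximalRealSubfield L)) L (IsCMField.complexConj L) 3 ((StdForm.antidiagonal 3).over L)).comp (Subgroup.inclusion (inf_le_left : (UnitaryGroup.arch (↥(maximalRealSubfield L)) L (IsCMField.complexConj L) 3 ((StdForm.antidiagonal 3).over L) ⊓ unitaryGroupOfForm (conjMixed (↥(maximalRealSubfield L)) L (IsCMField.complexConj L)) 1) ≤ UnitaryGroup.arch (↥(maximalRealSubfield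 L)) L (IsCMField.complexConj L) 3 ((StdForm.antidiagonal 3).over L))))) k v ∈ A)
    (h1 : (⨅ u : ↥(Kf.1), Module.End.eigenspace ((((quasiSplit (↥(maximalRealSubfield L)) L (IsCMField.complexConj L) 3).rightRegular μ) (finAdelicToAdelic (↥(maximalRealSubfield L)) L (IsCMField.complexConj L) 3 ((StdForm.antidiagonal 3).over L) (u : ↥(finAdelic (↥(maximalRealSubfield L)) L (IsCMField.complexConj L) 3 ((StdForm.antidiagonal 3).over L)))) :
        (quasiSplit (↥(maximalRealSubfield L)) L (IsCMField.complexConj L) 3).L2 μ →L[ℂ] (quasiSplit (↥(maximalRealSubfield L)) L (IsCMField.complexConj L) 3).L2 μ) : (quasiSplit (↥(maximalRealSubfield L)) L (IsCMField.complexConj L) 3).L2 μ →ₗ[ℂ] (quasiSplit (↥(maximalRealSubfield L)) L (IsCMField.complexConj L) 3).L2 μ) 1) ⊓ ((((quasiSplit (↥(maximalRealSubfield L)) L (IsCMField.complexConj L) 3).rightRegular μ).restrict ((archToAdelic (↥(maximalRealSubfield L)) L (IsCMField.complexConj L) 3 ((StdForm.antidiagonal 3).over L)).comp (Subgroup.inclusion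 (inf_le_left : (UnitaryGroup.arch (↥(maximalRealSubfield L)) L (IsCMField.complexConj L) 3 ((StdForm.antidiagonal 3).over L) ⊓ unitaryGroupOfForm (conjMixed (↥(maximalRealSubfield L)) L (IsCMField.complexConj L)) 1) ≤ UnitaryGroup.arch (↥(maximalRealSubfield L)) L (IsCMField.complexConj L) 3 ((StdForm.antidiagonal 3).over L))))).isotypicComponent τ.1.toContRep).toSubmodule ≤
      (⨅ k : ↥K', Module.End.eigenspace ((((quasiSplit (↥(maximalRealSubfield L)) L (IsCMField.complexConj L) 3).rightRegular μ) (K'.subtype k) : (quasiSplit (↥(maximalRealSubfield L)) L (IsCMField.complexConj L) 3).L2 μ →L[ℂ] (quasiSplit (↥(maximalRealSubfield L)) L (IsCMField.complexConj L) 3).L2 μ) :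
          (quasiSplit (↥(maximalRealSubfield L)) L (IsCMField.complexConj L) 3).L2 μ →ₗ[ℂ] (quasiSplit (↥(maximalRealSubfield L)) L (IsCMField.complexConj L) 3).L2 μ) (ω k)))
    (hcut : resGBlock L μ (Kf.1.map (finAdelicToAdelic (↥(maximalRealSubfield L)) L (IsCMField.complexConj L) 3 ((StdForm.antidiagonal 3).over L))) 1 χ₁ χ₂ ⊓ ((((quasiSplit (↥(maximalRealSubfield L)) L (IsCMField.complexConj L) 3).rightRegular μ).restrict ((archToAdelic (↥(maximalRealSubfield L)) L (IsCMField.complexConj L) 3 ((StdForm.antidiagonal 3).over L)).comp (Subgroup.inclusion (inf_le_left : (UnitaryGroup.arch (↥(maximalRealSubfield L)) L (IsCMField.complexConj L) 3 ((StdForm.antidiagonal 3).over L) ⊓ unitaryGroupOfForm (conjMixed (↥(maximalRealSubfield L)) L (IsCMField.complexConj L)) 1) ≤ UnitaryGroup.arch (↥(maximalRealSubfield L)) L (IsCMField.complexConj L) 3 ((StdForm.antidiagonal 3).over L))))).isotypicComponent τ.1.toContRep).toSubmodule ≤ resGBlock L μ K' ω χ₁ χ₂)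
    (h5 : ∀ W : ClosedSubrep ((quasiSplit (↥(maximalRealSubfield L)) L (IsCMField.complexConj L) 3).rightRegular μ), W.toContRep.IsTopIrreducible → W ≤ residualSubspace (quasiSplit (↥(maximalRealSubfield L)) L (IsCMField.complexConj L) 3) μ 𝔓 →
      W.toSubmodule ⊓ (⨅ k : ↥K', Module.End.eigenspace ((((quasiSplit (↥(maximalRealSubfield L)) L (IsCMField.complexConj L) 3).rightRegular μ) (K'.subtype k) : (quasiSplit (↥(maximalRealSubfield L)) L (IsCMField.complexConj L) 3).L2 μ →L[ℂ] (quasiSplit (↥(maximalRealSubfield L)) L (IsCMField.complexConj L) 3).L2 μ) :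
          (quasiSplit (↥(maximalRealSubfield L)) L (IsCMField.complexConj L) 3).L2 μ →ₗ[ℂ] (quasiSplit (↥(maximalRealSubfield L)) L (IsCMField.complexConj L) 3).L2 μ) (ω k)) ≤ (resGBlock L μ K' ω χ₁ χ₂ ⊓ A'ᗮ)ᗮ) :
    ∀ W : ClosedSubrep ((quasiSplit (↥(maximalRealSubfield L)) L (IsCMField.complexConj L) 3).rightRegular μ), W.toContRep.IsTopIrreducible → W ≤ residualSubspace (quasiSplit (↥(maximalRealSubfield L)) L (IsCMField.complexConj L) 3) μ 𝔓 →
      W.toSubmodule ⊓ ((⨅ u : ↥(Kf.1), Module.End.eigenspace ((((quasiSplit (↥(maximalRealSubfield L)) L (IsCMField.complexConj L) 3).rightRegular μ) (finAdelicToAdelic (↥(maximalRealSubfield L)) L (IsCMField.complexConj L) 3 ((StdForm.antidiagonal 3).over L) (u : ↥(finAdelic (↥(maximalRealSubfield L)) L (IsCMField.complexConj L) 3 ((StdForm.antidiagonal 3).over L)))) :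
        (quasiSplit (↥(maximalRealSubfield L)) L (IsCMField.complexConj L) 3).L2 μ →L[ℂ] (quasiSplit (↥(maximalRealSubfield L)) L (IsCMField.complexConj L) 3).L2 μ) : (quasiSplit (↥(maximalRealSubfield L)) L (IsCMField.complexConj L) 3).L2 μ →ₗ[ℂ] (quasiSplit (↥(maximalRealSubfield L)) L (IsCMField.complexConj L) 3).L2 μ) 1) ⊓ ((((quasiSplit (↥(maximalRealSubfield L)) L (IsCMField.complexConj L) 3).rightRegular μ).restrict ((archToAdelic (↥(maximalRealSubfield L)) L (IsCMField.complexConj L) 3 ((StdForm.antidiagonal 3).over L)).comp (Subgroup.inclusion (inf_le_left : (UnitaryGroup.arch (↥(maximalRealSubfield L)) L (IsCMField.complexConj L) 3 ((StdForm.antidiagonal 3).over L) ⊓ unitaryGroupOfForm (conjMixed (↥(maximalRealSubfield L)) L (IsCMField.complexConj L)) 1) ≤ UnitaryGroup.arch (↥(maximalRealSubfield L)) L (IsCMField.complexConj L) 3 ((StdForm.antidiagonal 3).over L))))).isotypicComponent τ.1.toContRep).toSubmodule) ≤ (resGBlock L μ (Kf.1.map (finAdelicToAdelic (↥(maximalRealSubfield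 L)) L (IsCMField.complexConj L) 3 ((StdForm.antidiagonal 3).over L))) 1 χ₁ χ₂ ⊓ Aᗮ)ᗮ := by
  intro W hW hres
  have hρ : ((((quasiSplit (↥(maximalRealSubfield L)) L (IsCMField.complexConj L) 3).rightRegular μ).restrict ((archToAdelic (↥(maximalRealSubfield L)) L (IsCMField.complexConj L) 3 ((StdForm.antidiagonal 3).over L)).comp (Subgroup.inclusion (inf_le_left : (UnitaryGroup.arch (↥(maximalRealSubfield L)) L (IsCMField.complexConj L) 3 ((StdForm.antidiagonal 3).over L) ⊓ unitaryGroupOfForm (conjMixed (↥(maximalRealSubfield L)) L (IsCMField.complexConj L)) 1) ≤ UnitaryGroup.arch (↥(maximalRealSubfield L)) L (IsCMField.complexConj L) 3 ((StdForm.antidiagonal 3).over L)))))).IsUnitary := fun k => ((quasiSplit (↥(maximalRealSubfield L)) L (IsCMField.complexConj L) 3).isUnitary_rightRegular μ) _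
  rw [← inf_assoc]
  refine inf_le_orthogonal_of_isotypic_cut ((((quasiSplit (↥(maximalRealSubfield L)) L (IsCMField.complexConj L) 3).rightRegular μ).restrict ((archToAdelic (↥(maximalRealSubfield L)) L (IsCMField.complexConj L) 3 ((StdForm.antidiagonal 3).over L)).comp (Subgroup.inclusion (inf_le_left : (UnitaryGroup.arch (↥(maximalRealSubfield L)) L (IsCMField.complexConj L) 3 ((StdForm.antidiagonal 3).over L) ⊓ unitaryGroupOfForm (conjMixed (↥(maximalRealSubfield L)) L (IsCMField.complexConj L)) 1) ≤ UnitaryGroup.arch (↥(maximalRealSubfield L)) L (IsCMField.complexConj L) 3 ((StdForm.antidiagonal 3).over L))))).isotypicComponent τ.1.toContRep).toSubmodule _ A _ A' _ (W.toSubmodule ⊓ (⨅ k : ↥K', Module.End.eigenspace ((((quasiSplit (↥(maximalRealSubfield L)) L (IsCMField.complexConj L) 3).rightRegular μ) (K'.subtype k) : (quasiSplit (↥(maximalRealSubfield L)) L (IsCMField.complexConj L) 3).L2 μ →L[ℂ] (quasiSplit (↥(maximalRealSubfield L)) L (IsCMField.complexConj L) 3).L2 μ) :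
          (quasiSplit (↥(maximalRealSubfield L)) L (IsCMField.complexConj L) 3).L2 μ →ₗ[ℂ] (quasiSplit (↥(maximalRealSubfield L)) L (IsCMField.complexConj L) 3).L2 μ) (ω k)))
    (fun x hx => starProjection_isotypicComponent_mem' hρ (isClosed_resGBlock L μ _ 1 χ₁ χ₂)
      (fun k v hv => restrict_archInfUnitaryOne_apply_mem_resGBlock L μ Kf.1 χ₁ hχ₂ k hv) hx)
    (fun x hx => starProjection_isotypicComponent_mem' hρ (Submodule.isClosed_orthogonal A)
      (fun k v hv => orthogonal_stable_of_stable hρ A hAstab k hv) hx)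
    hcut hA'A (fun w hw => ⟨hw.1.1, h1 ⟨hw.1.2, hw.2⟩⟩) (h5 W hW hres)

/-! ## §2 The type match at the `Kad` level `closure⟨ι_∞(K_∞) ∪ ι_f(Kf)⟩`, and the bridge with it discharged -/

/-- **TYPE MATCH AT `Kad(Kf)`**: if `N` lies in the `χ_∞`-eigenspace of `ρ = R ∘ ι_∞|_{K_∞}` and `ω : Kad(Kf) →* ℂ` restricts to `χ_∞` on `ι_∞(K_∞)` and to `1` on `ι_f(Kf)`, then
`Fix(ι_f Kf) ⊓ N ≤ Fix_{Kad(Kf)}(ω)` — induction over the subgroup generated (`Subgroup.closure_induction`): generators are eigen by `χ_∞` resp. fixed, products and inverses by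
multiplicativity of `R` and `ω` (`ω` never vanishes: `ω(g)ω(g⁻¹) = 1`). [cite: BorelJacquet1979, §4.1] [cite: DeitmarEchterhoff2014, §7.3] -/
theorem fixFin_inf_le_fix_kad (Kf : Subgroup ↥(finAdelic (↥(maximalRealSubfield L)) L (IsCMField.complexConj L) 3 ((StdForm.antidiagonal 3).over L))) (χinf : ↥(UnitaryGroup.arch (↥(maximalRealSubfield L)) L (IsCMField.complexConj L) 3 ((StdForm.antidiagonal 3).over L) ⊓ unitaryGroupOfForm (conjMixed (↥(maximalRealSubfield L)) L (IsCMField.complexConj L)) 1) → ℂ)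
    (N : Submodule ℂ ((quasiSplit (↥(maximalRealSubfield L)) L (IsCMField.complexConj L) 3).L2 μ)) (hN : ∀ v ∈ N, ∀ k : ↥(UnitaryGroup.arch (↥(maximalRealSubfield L)) L (IsCMField.complexConj L) 3 ((StdForm.antidiagonal 3).over L) ⊓ unitaryGroupOfForm (conjMixed (↥(maximalRealSubfield L)) L (IsCMField.complexConj L)) 1), (((quasiSplit (↥(maximalRealSubfield L)) L (IsCMField.complexConj L) 3).rightRegular μ).restrict ((archToAdelic (↥(maximalRealSubfield L)) L (IsCMField.complexConj L) 3 ((StdForm.antidiagonal 3).over L)).comp (Subgroup.inclusion (inf_le_left : (UnitaryGroup.arch (↥(maximalRealSubfield L)) L (IsCMField.complexConj L) 3 ((StdForm.antidiagonal 3).over L) ⊓ unitaryGroupOfForm (conjMixed (↥(maximalRealSubfield L)) L (IsCMField.complexConj L)) 1) ≤ UnitaryGroup.arch (↥(maximalRealSubfield L)) L (IsCMField.complexConj L) 3 ((StdForm.antidiagonal 3).over L))))) k v = χinf k • v)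
    (ω : ↥(Subgroup.closure ((Set.range (fun k : ↥(UnitaryGroup.arch (↥(maximalRealSubfield L)) L (IsCMField.complexConj L) 3 ((StdForm.antidiagonal 3).over L) ⊓ unitaryGroupOfForm (conjMixed (↥(maximalRealSubfield L)) L (IsCMField.complexConj L)) 1) => (archToAdelic (↥(maximalRealSubfield L)) L (IsCMField.complexConj L) 3 ((StdForm.antidiagonal 3).over L)) ((Subgroup.inclusion (inf_le_left : (UnitaryGroup.arch (↥(maximalRealSubfield L)) L (IsCMField.complexConj L) 3 ((StdForm.antidiagonal 3).over L) ⊓ unitaryGroupOfForm (conjMixed (↥(maximalRealSubfield L)) L (IsCMField.complexConj L)) 1) ≤ UnitaryGroup.arch (↥(maximalRealSubfield L)) L (IsCMField.complexConj L) 3 ((StdForm.antidiagonal 3).over L))) k))) ∪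
            ((finAdelicToAdelic (↥(maximalRealSubfield L)) L (IsCMField.complexConj L) 3 ((StdForm.antidiagonal 3).over L)) '' ((Kf : Subgroup ↥(finAdelic (↥(maximalRealSubfield L)) L (IsCMField.complexConj L) 3 ((StdForm.antidiagonal 3).over L))) : Set ↥(finAdelic (↥(maximalRealSubfield L)) L (IsCMField.complexConj L) 3 ((StdForm.antidiagonal 3).over L)))))) →* ℂ)
    (hωinf : ∀ k : ↥(UnitaryGroup.arch (↥(maximalRealSubfield L)) L (IsCMField.complexConj L) 3 ((StdForm.antidiagonal 3).over L) ⊓ unitaryGroupOfForm (conjMixed (↥(maximalRealSubfield L)) L (IsCMField.complexConj L)) 1), ω ⟨(archToAdelic (↥(maximalRealSubfield L)) L (IsCMField.complexConj L) 3 ((StdForm.antidiagonal 3).over L)) ((Subgroup.inclusion (inf_le_left : (UnitaryGroup.arch (↥(maximalRealSubfield L)) L (IsCMField.complexConj L) 3 ((StdForm.antidiagonal 3).over L) ⊓ unitaryGroupOfForm (conjMixed (↥(maximalRealSubfield L)) L (IsCMField.complexConj L)) 1) ≤ UnitaryGroup.arch (↥(maximalRealSubfield L)) L (IsCMField.complexConj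 L) 3 ((StdForm.antidiagonal 3).over L))) k), Subgroup.subset_closure (Or.inl ⟨k, rfl⟩)⟩ = χinf k)
    (hω1 : ∀ (u : ↥(finAdelic (↥(maximalRealSubfield L)) L (IsCMField.complexConj L) 3 ((StdForm.antidiagonal 3).over L))) (hu : u ∈ Kf), ω ⟨(finAdelicToAdelic (↥(maximalRealSubfield L)) L (IsCMField.complexConj L) 3 ((StdForm.antidiagonal 3).over L)) u, Subgroup.subset_closure (Or.inr ⟨u, hu, rfl⟩)⟩ = 1) :
    (⨅ u : ↥(Kf), Module.End.eigenspace ((((quasiSplit (↥(maximalRealSubfield L)) L (IsCMField.complexConj L) 3).rightRegular μ) (finAdelicToAdelic (↥(maximalRealSubfield L)) L (IsCMField.complexConj L) 3 ((StdForm.antidiagonal 3).over L) (u : ↥(finAdelic (↥(maximalRealSubfield L)) L (IsCMField.complexConj L) 3 ((StdForm.antidiagonal 3).over L)))) :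
        (quasiSplit (↥(maximalRealSubfield L)) L (IsCMField.complexConj L) 3).L2 μ →L[ℂ] (quasiSplit (↥(maximalRealSubfield L)) L (IsCMField.complexConj L) 3).L2 μ) : (quasiSplit (↥(maximalRealSubfield L)) L (IsCMField.complexConj L) 3).L2 μ →ₗ[ℂ] (quasiSplit (↥(maximalRealSubfield L)) L (IsCMField.complexConj L) 3).L2 μ) 1) ⊓ N ≤ (⨅ k : ↥(Subgroup.closure ((Set.range (fun k : ↥(UnitaryGroup.arch (↥(maximalRealSubfield L)) L (IsCMField.complexConj L) 3 ((StdForm.antidiagonal 3).over L) ⊓ unitaryGroupOfForm (conjMixed (↥(maximalRealSubfield L)) L (IsCMField.complexConj L)) 1) => (archToAdelic (↥(maximalRealSubfield L)) L (IsCMField.complexConj L) 3 ((StdForm.antidiagonal 3).over L)) ((Subgroup.inclusion (inf_le_left : (UnitaryGroup.arch (↥(maximalRealSubfield L)) L (IsCMField.complexConj L) 3 ((StdForm.antidiagonal 3).over L) ⊓ unitaryGroupOfForm (conjMixed (↥(maximalRealSubfield L)) L (IsCMField.complexConj L)) 1) ≤ UnitaryGroup.arch (↥(maximalRealSubfield L))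 L (IsCMField.complexConj L) 3 ((StdForm.antidiagonal 3).over L))) k))) ∪
            ((finAdelicToAdelic (↥(maximalRealSubfield L)) L (IsCMField.complexConj L) 3 ((StdForm.antidiagonal 3).over L)) '' ((Kf : Subgroup ↥(finAdelic (↥(maximalRealSubfield L)) L (IsCMField.complexConj L) 3 ((StdForm.antidiagonal 3).over L))) : Set ↥(finAdelic (↥(maximalRealSubfield L)) L (IsCMField.complexConj L) 3 ((StdForm.antidiagonal 3).over L)))))), Module.End.eigenspace ((((quasiSplit (↥(maximalRealSubfield L)) L (IsCMField.complexConj L) 3).rightRegular μ) (((Subgroup.closure ((Set.range (fun k : ↥(UnitaryGroup.arch (↥(maximalRealSubfield L)) L (IsCMField.complexConj L) 3 ((StdForm.antidiagonal 3).over L) ⊓ unitaryGroupOfForm (conjMixed (↥(maximalRealSubfield L)) L (IsCMField.complexConj L)) 1) => (archToAdelic (↥(maximalRealSubfield L)) L (IsCMField.complexConj L) 3 ((StdForm.antidiagonal 3).over L)) ((Subgroup.inclusion (inf_le_left : (UnitaryGroup.arch (↥(maximalRealSubfield L)) L (IsCMField.complexConj L) 3 ((StdForm.antidiagonal 3).over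 L) ⊓ unitaryGroupOfForm (conjMixed (↥(maximalRealSubfield L)) L (IsCMField.complexConj L)) 1) ≤ UnitaryGroup.arch (↥(maximalRealSubfield L)) L (IsCMField.complexConj L) 3 ((StdForm.antidiagonal 3).over L))) k))) ∪
            ((finAdelicToAdelic (↥(maximalRealSubfield L)) L (IsCMField.complexConj L) 3 ((StdForm.antidiagonal 3).over L)) '' ((Kf : Subgroup ↥(finAdelic (↥(maximalRealSubfield L)) L (IsCMField.complexConj L) 3 ((StdForm.antidiagonal 3).over L))) : Set ↥(finAdelic (↥(maximalRealSubfield L)) L (IsCMField.complexConj L) 3 ((StdForm.antidiagonal 3).over L))))))).subtype k) : (quasiSplit (↥(maximalRealSubfield L)) L (IsCMField.complexConj L) 3).L2 μ →L[ℂ] (quasiSplit (↥(maximalRealSubfield L)) L (IsCMField.complexConj L) 3).L2 μ) :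
          (quasiSplit (↥(maximalRealSubfield L)) L (IsCMField.complexConj L) 3).L2 μ →ₗ[ℂ] (quasiSplit (↥(maximalRealSubfield L)) L (IsCMField.complexConj L) 3).L2 μ) (ω k)) := by
  rintro v ⟨hvF, hvN⟩
  refine (Submodule.mem_iInf _).2 fun k => Module.End.mem_eigenspace_iff.2 ?_
  obtain ⟨g, hg⟩ := k
  show ((quasiSplit (↥(maximalRealSubfield L)) L (IsCMField.complexConj L) 3).rightRegular μ) g v = ω ⟨g, hg⟩ • v
  -- induction over `Kad(Kf) = closure (ι_∞(K_∞) ∪ ι_f(Kf))`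
  induction hg using Subgroup.closure_induction with
  | mem g hg =>
    rcases hg with ⟨k₀, rfl⟩ | ⟨u, hu, rfl⟩
    · -- archimedean generator: `R(ι_∞ k₀) v = χ_∞(k₀) • v = ω • v`
      rw [hωinf k₀, ← hN v hvN k₀, ContRepresentation.restrict_apply, MonoidHom.coe_comp, Function.comp_apply]
    · -- finite generator: `R(ι_f u) v = v = ω • v`
      rw [hω1 u hu, one_smul]
      exact (Module.End.mem_eigenspace_iff.1 ((Submodule.mem_iInf _).1 hvF ⟨u, hu⟩)).trans (one_smul ℂ v)
  | one =>
    have h1 : (⟨1, Subgroup.one_mem _⟩ : ↥(Subgroup.closure ((Set.range (fun k : ↥(UnitaryGroup.arch (↥(maximalRealSubfield L)) L (IsCMField.complexConj L) 3 ((StdForm.antidiagonal 3).over L) ⊓ unitaryGroupOfForm (conjMixed (↥(maximalRealSubfield L)) L (IsCMField.complexConj L)) 1) => (archToAdelic (↥(maximalRealSubfield L)) L (IsCMField.complexConj L) 3 ((StdForm.antidiagonal 3).over L)) ((Subgroup.inclusion (inf_le_left : (UnitaryGroup.arch (↥(maximalRealSubfield L)) L (IsCMField.complexConj L) 3 ((StdForm.antidiagonal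 3).over L) ⊓ unitaryGroupOfForm (conjMixed (↥(maximalRealSubfield L)) L (IsCMField.complexConj L)) 1) ≤ UnitaryGroup.arch (↥(maximalRealSubfield L)) L (IsCMField.complexConj L) 3 ((StdForm.antidiagonal 3).over L))) k))) ∪
            ((finAdelicToAdelic (↥(maximalRealSubfield L)) L (IsCMField.complexConj L) 3 ((StdForm.antidiagonal 3).over L)) '' ((Kf : Subgroup ↥(finAdelic (↥(maximalRealSubfield L)) L (IsCMField.complexConj L) 3 ((StdForm.antidiagonal 3).over L))) : Set ↥(finAdelic (↥(maximalRealSubfield L)) L (IsCMField.complexConj L) 3 ((StdForm.antidiagonal 3).over L))))))) = 1 := rfl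
    rw [h1, map_one ω, map_one ((quasiSplit (↥(maximalRealSubfield L)) L (IsCMField.complexConj L) 3).rightRegular μ), ContinuousLinearMap.one_def, ContinuousLinearMap.id_apply, one_smul]
  | mul x y hx hy hpx hpy =>
    have hxy : (⟨x * y, Subgroup.mul_mem _ hx hy⟩ : ↥(Subgroup.closure ((Set.range (fun k : ↥(UnitaryGroup.arch (↥(maximalRealSubfield L)) L (IsCMField.complexConj L) 3 ((StdForm.antidiagonal 3).over L) ⊓ unitaryGroupOfForm (conjMixed (↥(maximalRealSubfield L)) L (IsCMField.complexConj L)) 1) => (archToAdelic (↥(maximalRealSubfield L)) L (IsCMField.complexConj L) 3 ((StdForm.antidiagonal 3).over L)) ((Subgroup.inclusion (inf_le_left : (UnitaryGroup.arch (↥(maximalRealSubfield L)) L (IsCMField.complexConj L) 3 ((StdForm.antidiagonal 3).over L) ⊓ unitaryGroupOfForm (conjMixed (↥(maximalRealSubfield L)) L (IsCMField.complexConj L)) 1) ≤ UnitaryGroup.arch (↥(maximalRealSubfield L)) L (IsCMField.complexConj L) 3 ((StdForm.antidiagonal 3).over L))) k))) ∪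
            ((finAdelicToAdelic (↥(maximalRealSubfield L)) L (IsCMField.complexConj L) 3 ((StdForm.antidiagonal 3).over L)) '' ((Kf : Subgroup ↥(finAdelic (↥(maximalRealSubfield L)) L (IsCMField.complexConj L) 3 ((StdForm.antidiagonal 3).over L))) : Set ↥(finAdelic (↥(maximalRealSubfield L)) L (IsCMField.complexConj L) 3 ((StdForm.antidiagonal 3).over L))))))) = ⟨x, hx⟩ * ⟨y, hy⟩ := rfl
    -- term-mode steps (no `rw` whose closing `rfl` would unfold the `L²` scalar action)
    calc ((quasiSplit (↥(maximalRealSubfield L)) L (IsCMField.complexConj L) 3).rightRegular μ) (x * y) v = ((quasiSplit (↥(maximalRealSubfield L)) L (IsCMField.complexConj L) 3).rightRegular μ) x (((quasiSplit (↥(maximalRealSubfield L)) L (IsCMField.complexConj L) 3).rightRegular μ) y v) := by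
          rw [map_mul ((quasiSplit (↥(maximalRealSubfield L)) L (IsCMField.complexConj L) 3).rightRegular μ) x y, ContinuousLinearMap.mul_def, ContinuousLinearMap.comp_apply]
      _ = ((quasiSplit (↥(maximalRealSubfield L)) L (IsCMField.complexConj L) 3).rightRegular μ) x (ω ⟨y, hy⟩ • v) := congrArg (((quasiSplit (↥(maximalRealSubfield L)) L (IsCMField.complexConj L) 3).rightRegular μ) x) hpy
      _ = ω ⟨y, hy⟩ • ((quasiSplit (↥(maximalRealSubfield L)) L (IsCMField.complexConj L) 3).rightRegular μ) x v := map_smul _ _ _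
      _ = ω ⟨y, hy⟩ • (ω ⟨x, hx⟩ • v) := congrArg (fun w => ω ⟨y, hy⟩ • w) hpx
      _ = (ω ⟨y, hy⟩ * ω ⟨x, hx⟩) • v := smul_smul _ _ _
      _ = (ω ⟨x, hx⟩ * ω ⟨y, hy⟩) • v := congrArg (fun c : ℂ => c • v) (mul_comm _ _)
      _ = ω (⟨x, hx⟩ * ⟨y, hy⟩) • v := congrArg (fun c : ℂ => c • v) (map_mul ω _ _).symm
      _ = ω ⟨x * y, Subgroup.mul_mem _ hx hy⟩ • v := by rw [hxy]
  | inv x hx hpx =>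
    have hxi : (⟨x⁻¹, Subgroup.inv_mem _ hx⟩ : ↥(Subgroup.closure ((Set.range (fun k : ↥(UnitaryGroup.arch (↥(maximalRealSubfield L)) L (IsCMField.complexConj L) 3 ((StdForm.antidiagonal 3).over L) ⊓ unitaryGroupOfForm (conjMixed (↥(maximalRealSubfield L)) L (IsCMField.complexConj L)) 1) => (archToAdelic (↥(maximalRealSubfield L)) L (IsCMField.complexConj L) 3 ((StdForm.antidiagonal 3).over L)) ((Subgroup.inclusion (inf_le_left : (UnitaryGroup.arch (↥(maximalRealSubfield L)) L (IsCMField.complexConj L) 3 ((StdForm.antidiagonal 3).over L) ⊓ unitaryGroupOfForm (conjMixed (↥(maximalRealSubfield L)) L (IsCMField.complexConj L)) 1) ≤ UnitaryGroup.arch (↥(maximalRealSubfield L)) L (IsCMField.complexConj L) 3 ((StdForm.antidiagonal 3).over L))) k))) ∪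
            ((finAdelicToAdelic (↥(maximalRealSubfield L)) L (IsCMField.complexConj L) 3 ((StdForm.antidiagonal 3).over L)) '' ((Kf : Subgroup ↥(finAdelic (↥(maximalRealSubfield L)) L (IsCMField.complexConj L) 3 ((StdForm.antidiagonal 3).over L))) : Set ↥(finAdelic (↥(maximalRealSubfield L)) L (IsCMField.complexConj L) 3 ((StdForm.antidiagonal 3).over L))))))) = ⟨x, hx⟩⁻¹ := rfl
    have hmul : ω ⟨x, hx⟩ * ω ⟨x⁻¹, Subgroup.inv_mem _ hx⟩ = 1 := by
      rw [hxi, ← map_mul ω, mul_inv_cancel, map_one]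
    have hne : ω ⟨x, hx⟩ ≠ 0 := left_ne_zero_of_mul_eq_one hmul
    -- `ω(x) • R(x⁻¹) v = R(x⁻¹) (R(x) v) = v`
    have key : ω ⟨x, hx⟩ • ((quasiSplit (↥(maximalRealSubfield L)) L (IsCMField.complexConj L) 3).rightRegular μ) x⁻¹ v = v := by
      have h' : ((quasiSplit (↥(maximalRealSubfield L)) L (IsCMField.complexConj L) 3).rightRegular μ) x⁻¹ (((quasiSplit (↥(maximalRealSubfield L)) L (IsCMField.complexConj L) 3).rightRegular μ) x v) = v := by
        rw [← ContinuousLinearMap.comp_apply, ← ContinuousLinearMap.mul_def, ← map_mul ((quasiSplit (↥(maximalRealSubfield L)) L (IsCMField.complexConj L) 3).rightRegular μ), inv_mul_cancel,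
          map_one ((quasiSplit (↥(maximalRealSubfield L)) L (IsCMField.complexConj L) 3).rightRegular μ), ContinuousLinearMap.one_def, ContinuousLinearMap.id_apply]
      have hs : ((quasiSplit (↥(maximalRealSubfield L)) L (IsCMField.complexConj L) 3).rightRegular μ) x⁻¹ (ω ⟨x, hx⟩ • v) = ω ⟨x, hx⟩ • ((quasiSplit (↥(maximalRealSubfield L)) L (IsCMField.complexConj L) 3).rightRegular μ) x⁻¹ v := map_smul _ _ _
      rewrite [hpx, hs] at h'
      exact h'
    have key2 := congrArg (fun w => (ω ⟨x, hx⟩)⁻¹ • w) key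
    simp only [smul_smul, inv_mul_cancel₀ hne, one_smul] at key2
    rewrite [show ω ⟨x⁻¹, Subgroup.inv_mem _ hx⟩ = (ω ⟨x, hx⟩)⁻¹ from eq_inv_of_mul_eq_one_right hmul]
    exact key2

/-- **THE BRIDGE AT THE `Kad` LEVEL** — §1 with (h1) DISCHARGED by §2: for a `K_∞`-type piece `N_τ` inside the `χ_∞`-eigenspace (a 1-dimensional type) and `ω : Kad(Kf) →* ℂ` extending
`χ_∞` and `1`, the letters (h2) `A` `K_∞`-stable, (h3) isotypic cut `Sc ⊓ N_τ ≤ Sc(Kad Kf, ω)`, (h4) `A′ ≤ A`, (h5) D5′'s output at `(Kad Kf, ω, A′)` give the `hτ Kf b τ` bytes of ★ `hNblk_of_kTypes`.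
[cite: DeitmarEchterhoff2014, Prop. 7.3.3] [cite: MoeglinWaldspurger1995, II.1.1, VI.2] [cite: BorelJacquet1979, §4.1, §4.6] -/
theorem hτ_of_kadLevel (𝔓 : (quasiSplit (↥(maximalRealSubfield L)) L (IsCMField.complexConj L) 3).ParabolicUnipotentData) (Kf : {Kf : Subgroup ↥(finAdelic (↥(maximalRealSubfield L)) L (IsCMField.complexConj L) 3 ((StdForm.antidiagonal 3).over L)) // IsOpen ((Kf : Subgroup ↥(finAdelic (↥(maximalRealSubfield L)) L (IsCMField.complexConj L) 3 ((StdForm.antidiagonal 3).over L))) : Set ↥(finAdelic (↥(maximalRealSubfield L)) L (IsCMField.complexConj L) 3 ((StdForm.antidiagonal 3).over L))) ∧ Kf ≤ ((((standardMaximalCompactGL 3 L).comap (adelicVal (↥(maximalRealSubfield L)) L (IsCMField.complexConj L) 3 ((StdForm.antidiagonal 3).over L)) : Subgroup (quasiSplit (↥(maximalRealSubfield L)) L (IsCMField.complexConj L) 3).Adelic)).comap (finAdelicToAdelic (↥(maximalRealSubfield L)) L (IsCMField.complexConj L) 3 ((StdForm.antidiagonal 3).over L)) : Subgroup ↥(finAdelic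 (↥(maximalRealSubfield L)) L (IsCMField.complexConj L) 3 ((StdForm.antidiagonal 3).over L)))})
    (χ₁ : HeckeCharacter L) {χ₂ : ↥(TorusDict.torus (IsCMField.complexConj L)) →ₜ* ℂˣ} (hχ₂ : TorusDict.IsAutomorphic (IsCMField.complexConj L) χ₂)
    (τ : {U : ClosedSubrep (((quasiSplit (↥(maximalRealSubfield L)) L (IsCMField.complexConj L) 3).rightRegular μ).restrict ((archToAdelic (↥(maximalRealSubfield L)) L (IsCMField.complexConj L) 3 ((StdForm.antidiagonal 3).over L)).comp (Subgroup.inclusion (inf_le_left : (UnitaryGroup.arch (↥(maximalRealSubfield L)) L (IsCMField.complexConj L) 3 ((StdForm.antidiagonal 3).over L) ⊓ unitaryGroupOfForm (conjMixed (↥(maximalRealSubfield L)) L (IsCMField.complexConj L)) 1) ≤ UnitaryGroup.arch (↥(maximalRealSubfield L)) L (IsCMField.complexConj L) 3 ((StdForm.antidiagonal 3).over L))))) // U.toContRep.IsTopIrreducible}) (χinf : ↥(UnitaryGroup.arch (↥(maximalRealSubfield L)) L (IsCMField.complexConj L) 3 ((StdForm.antidiagonal 3).over L) ⊓ unitaryGroupOfForm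 (conjMixed (↥(maximalRealSubfield L)) L (IsCMField.complexConj L)) 1) → ℂ)
    (hτχ : ∀ v ∈ ((((quasiSplit (↥(maximalRealSubfield L)) L (IsCMField.complexConj L) 3).rightRegular μ).restrict ((archToAdelic (↥(maximalRealSubfield L)) L (IsCMField.complexConj L) 3 ((StdForm.antidiagonal 3).over L)).comp (Subgroup.inclusion (inf_le_left : (UnitaryGroup.arch (↥(maximalRealSubfield L)) L (IsCMField.complexConj L) 3 ((StdForm.antidiagonal 3).over L) ⊓ unitaryGroupOfForm (conjMixed (↥(maximalRealSubfield L)) L (IsCMField.complexConj L)) 1) ≤ UnitaryGroup.arch (↥(maximalRealSubfield L)) L (IsCMField.complexConj L) 3 ((StdForm.antidiagonal 3).over L))))).isotypicComponent τ.1.toContRep).toSubmodule, ∀ k : ↥(UnitaryGroup.arch (↥(maximalRealSubfield L)) L (IsCMField.complexConj L) 3 ((StdForm.antidiagonal 3).over L) ⊓ unitaryGroupOfForm (conjMixed (↥(maximalRealSubfield L)) L (IsCMField.complexConj L)) 1), (((quasiSplit (↥(maximalRealSubfield L)) L (IsCMField.complexConj L) 3).rightRegular μ).restrict ((archToAdelic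 (↥(maximalRealSubfield L)) L (IsCMField.complexConj L) 3 ((StdForm.antidiagonal 3).over L)).comp (Subgroup.inclusion (inf_le_left : (UnitaryGroup.arch (↥(maximalRealSubfield L)) L (IsCMField.complexConj L) 3 ((StdForm.antidiagonal 3).over L) ⊓ unitaryGroupOfForm (conjMixed (↥(maximalRealSubfield L)) L (IsCMField.complexConj L)) 1) ≤ UnitaryGroup.arch (↥(maximalRealSubfield L)) L (IsCMField.complexConj L) 3 ((StdForm.antidiagonal 3).over L))))) k v = χinf k • v)
    (ω : ↥(Subgroup.closure ((Set.range (fun k : ↥(UnitaryGroup.arch (↥(maximalRealSubfield L)) L (IsCMField.complexConj L) 3 ((StdForm.antidiagonal 3).over L) ⊓ unitaryGroupOfForm (conjMixed (↥(maximalRealSubfield L)) L (IsCMField.complexConj L)) 1) => (archToAdelic (↥(maximalRealSubfield L)) L (IsCMField.complexConj L) 3 ((StdForm.antidiagonal 3).over L)) ((Subgroup.inclusion (inf_le_left : (UnitaryGroup.arch (↥(maximalRealSubfield L)) L (IsCMField.complexConj L) 3 ((StdForm.antidiagonal 3).over L) ⊓ unitaryGroupOfForm (conjMixed (↥(maximalRealSubfield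 L)) L (IsCMField.complexConj L)) 1) ≤ UnitaryGroup.arch (↥(maximalRealSubfield L)) L (IsCMField.complexConj L) 3 ((StdForm.antidiagonal 3).over L))) k))) ∪
            ((finAdelicToAdelic (↥(maximalRealSubfield L)) L (IsCMField.complexConj L) 3 ((StdForm.antidiagonal 3).over L)) '' ((Kf.1 : Subgroup ↥(finAdelic (↥(maximalRealSubfield L)) L (IsCMField.complexConj L) 3 ((StdForm.antidiagonal 3).over L))) : Set ↥(finAdelic (↥(maximalRealSubfield L)) L (IsCMField.complexConj L) 3 ((StdForm.antidiagonal 3).over L)))))) →* ℂ)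
    (hωinf : ∀ k : ↥(UnitaryGroup.arch (↥(maximalRealSubfield L)) L (IsCMField.complexConj L) 3 ((StdForm.antidiagonal 3).over L) ⊓ unitaryGroupOfForm (conjMixed (↥(maximalRealSubfield L)) L (IsCMField.complexConj L)) 1), ω ⟨(archToAdelic (↥(maximalRealSubfield L)) L (IsCMField.complexConj L) 3 ((StdForm.antidiagonal 3).over L)) ((Subgroup.inclusion (inf_le_left : (UnitaryGroup.arch (↥(maximalRealSubfield L)) L (IsCMField.complexConj L) 3 ((StdForm.antidiagonal 3).over L) ⊓ unitaryGroupOfForm (conjMixed (↥(maximalRealSubfield L)) L (IsCMField.complexConj L)) 1) ≤ UnitaryGroup.arch (↥(maximalRealSubfield L)) L (IsCMField.complexConj L) 3 ((StdForm.antidiagonal 3).over L))) k), Subgroup.subset_closure (Or.inl ⟨k, rfl⟩)⟩ = χinf k)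
    (hω1 : ∀ (u : ↥(finAdelic (↥(maximalRealSubfield L)) L (IsCMField.complexConj L) 3 ((StdForm.antidiagonal 3).over L))) (hu : u ∈ Kf.1), ω ⟨(finAdelicToAdelic (↥(maximalRealSubfield L)) L (IsCMField.complexConj L) 3 ((StdForm.antidiagonal 3).over L)) u, Subgroup.subset_closure (Or.inr ⟨u, hu, rfl⟩)⟩ = 1)
    (A A' : Submodule ℂ ((quasiSplit (↥(maximalRealSubfield L)) L (IsCMField.complexConj L) 3).L2 μ)) (hA'A : A' ≤ A) (hAstab : ∀ (k : ↥(UnitaryGroup.arch (↥(maximalRealSubfield L)) L (IsCMField.complexConj L) 3 ((StdForm.antidiagonal 3).over L) ⊓ unitaryGroupOfForm (conjMixed (↥(maximalRealSubfield L)) L (IsCMField.complexConj L)) 1)), ∀ v ∈ A, (((quasiSplit (↥(maximalRealSubfield L)) L (IsCMField.complexConj L) 3).rightRegular μ).restrict ((archToAdelic (↥(maximalRealSubfield L)) L (IsCMField.complexConj L) 3 ((StdForm.antidiagonal 3).over L)).comp (Subgroup.inclusion (inf_le_left : (UnitaryGroup.arch (↥(maximalRealSubfield L)) L (IsCMField.complexConj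 L) 3 ((StdForm.antidiagonal 3).over L) ⊓ unitaryGroupOfForm (conjMixed (↥(maximalRealSubfield L)) L (IsCMField.complexConj L)) 1) ≤ UnitaryGroup.arch (↥(maximalRealSubfield L)) L (IsCMField.complexConj L) 3 ((StdForm.antidiagonal 3).over L))))) k v ∈ A)
    (hcut : resGBlock L μ (Kf.1.map (finAdelicToAdelic (↥(maximalRealSubfield L)) L (IsCMField.complexConj L) 3 ((StdForm.antidiagonal 3).over L))) 1 χ₁ χ₂ ⊓ ((((quasiSplit (↥(maximalRealSubfield L)) L (IsCMField.complexConj L) 3).rightRegular μ).restrict ((archToAdelic (↥(maximalRealSubfield L)) L (IsCMField.complexConj L) 3 ((StdForm.antidiagonal 3).over L)).comp (Subgroup.inclusion (inf_le_left : (UnitaryGroup.arch (↥(maximalRealSubfield L)) L (IsCMField.complexConj L) 3 ((StdForm.antidiagonal 3).over L) ⊓ unitaryGroupOfForm (conjMixed (↥(maximalRealSubfield L)) L (IsCMField.complexConj L)) 1) ≤ UnitaryGroup.arch (↥(maximalRealSubfield L)) L (IsCMField.complexConj L) 3 ((StdForm.antidiagonal 3).over L))))).isotypicComponent τ.1.toContRep).toSubmodule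 ≤ resGBlock L μ (Subgroup.closure ((Set.range (fun k : ↥(UnitaryGroup.arch (↥(maximalRealSubfield L)) L (IsCMField.complexConj L) 3 ((StdForm.antidiagonal 3).over L) ⊓ unitaryGroupOfForm (conjMixed (↥(maximalRealSubfield L)) L (IsCMField.complexConj L)) 1) => (archToAdelic (↥(maximalRealSubfield L)) L (IsCMField.complexConj L) 3 ((StdForm.antidiagonal 3).over L)) ((Subgroup.inclusion (inf_le_left : (UnitaryGroup.arch (↥(maximalRealSubfield L)) L (IsCMField.complexConj L) 3 ((StdForm.antidiagonal 3).over L) ⊓ unitaryGroupOfForm (conjMixed (↥(maximalRealSubfield L)) L (IsCMField.complexConj L)) 1) ≤ UnitaryGroup.arch (↥(maximalRealSubfield L)) L (IsCMField.complexConj L) 3 ((StdForm.antidiagonal 3).over L))) k))) ∪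
            ((finAdelicToAdelic (↥(maximalRealSubfield L)) L (IsCMField.complexConj L) 3 ((StdForm.antidiagonal 3).over L)) '' ((Kf.1 : Subgroup ↥(finAdelic (↥(maximalRealSubfield L)) L (IsCMField.complexConj L) 3 ((StdForm.antidiagonal 3).over L))) : Set ↥(finAdelic (↥(maximalRealSubfield L)) L (IsCMField.complexConj L) 3 ((StdForm.antidiagonal 3).over L)))))) ω χ₁ χ₂)
    (h5 : ∀ W : ClosedSubrep ((quasiSplit (↥(maximalRealSubfield L)) L (IsCMField.complexConj L) 3).rightRegular μ), W.toContRep.IsTopIrreducible → W ≤ residualSubspace (quasiSplit (↥(maximalRealSubfield L)) L (IsCMField.complexConj L) 3) μ 𝔓 →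
      W.toSubmodule ⊓ (⨅ k : ↥(Subgroup.closure ((Set.range (fun k : ↥(UnitaryGroup.arch (↥(maximalRealSubfield L)) L (IsCMField.complexConj L) 3 ((StdForm.antidiagonal 3).over L) ⊓ unitaryGroupOfForm (conjMixed (↥(maximalRealSubfield L)) L (IsCMField.complexConj L)) 1) => (archToAdelic (↥(maximalRealSubfield L)) L (IsCMField.complexConj L) 3 ((StdForm.antidiagonal 3).over L)) ((Subgroup.inclusion (inf_le_left : (UnitaryGroup.arch (↥(maximalRealSubfield L)) L (IsCMField.complexConj L) 3 ((StdForm.antidiagonal 3).over L) ⊓ unitaryGroupOfForm (conjMixed (↥(maximalRealSubfield L)) L (IsCMField.complexConj L)) 1) ≤ UnitaryGroup.arch (↥(maximalRealSubfield L)) L (IsCMField.complexConj L) 3 ((StdForm.antidiagonal 3).over L))) k))) ∪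
            ((finAdelicToAdelic (↥(maximalRealSubfield L)) L (IsCMField.complexConj L) 3 ((StdForm.antidiagonal 3).over L)) '' ((Kf.1 : Subgroup ↥(finAdelic (↥(maximalRealSubfield L)) L (IsCMField.complexConj L) 3 ((StdForm.antidiagonal 3).over L))) : Set ↥(finAdelic (↥(maximalRealSubfield L)) L (IsCMField.complexConj L) 3 ((StdForm.antidiagonal 3).over L)))))), Module.End.eigenspace ((((quasiSplit (↥(maximalRealSubfield L)) L (IsCMField.complexConj L) 3).rightRegular μ) (((Subgroup.closure ((Set.range (fun k : ↥(UnitaryGroup.arch (↥(maximalRealSubfield L)) L (IsCMField.complexConj L) 3 ((StdForm.antidiagonal 3).over L) ⊓ unitaryGroupOfForm (conjMixed (↥(maximalRealSubfield L)) L (IsCMField.complexConj L)) 1) => (archToAdelic (↥(maximalRealSubfield L)) L (IsCMField.complexConj L) 3 ((StdForm.antidiagonal 3).over L)) ((Subgroup.inclusion (inf_le_left : (UnitaryGroup.arch (↥(maximalRealSubfield L)) L (IsCMField.complexConj L) 3 ((StdForm.antidiagonal 3).over L) ⊓ unitaryGroupOfForm (conjMixed (↥(maximalRealSubfield L)) L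 (IsCMField.complexConj L)) 1) ≤ UnitaryGroup.arch (↥(maximalRealSubfield L)) L (IsCMField.complexConj L) 3 ((StdForm.antidiagonal 3).over L))) k))) ∪
            ((finAdelicToAdelic (↥(maximalRealSubfield L)) L (IsCMField.complexConj L) 3 ((StdForm.antidiagonal 3).over L)) '' ((Kf.1 : Subgroup ↥(finAdelic (↥(maximalRealSubfield L)) L (IsCMField.complexConj L) 3 ((StdForm.antidiagonal 3).over L))) : Set ↥(finAdelic (↥(maximalRealSubfield L)) L (IsCMField.complexConj L) 3 ((StdForm.antidiagonal 3).over L))))))).subtype k) : (quasiSplit (↥(maximalRealSubfield L)) L (IsCMField.complexConj L) 3).L2 μ →L[ℂ] (quasiSplit (↥(maximalRealSubfield L)) L (IsCMField.complexConj L) 3).L2 μ) :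
          (quasiSplit (↥(maximalRealSubfield L)) L (IsCMField.complexConj L) 3).L2 μ →ₗ[ℂ] (quasiSplit (↥(maximalRealSubfield L)) L (IsCMField.complexConj L) 3).L2 μ) (ω k)) ≤ (resGBlock L μ (Subgroup.closure ((Set.range (fun k : ↥(UnitaryGroup.arch (↥(maximalRealSubfield L)) L (IsCMField.complexConj L) 3 ((StdForm.antidiagonal 3).over L) ⊓ unitaryGroupOfForm (conjMixed (↥(maximalRealSubfield L)) L (IsCMField.complexConj L)) 1) => (archToAdelic (↥(maximalRealSubfield L)) L (IsCMField.complexConj L) 3 ((StdForm.antidiagonal 3).over L)) ((Subgroup.inclusion (inf_le_left : (UnitaryGroup.arch (↥(maximalRealSubfield L)) L (IsCMField.complexConj L) 3 ((StdForm.antidiagonal 3).over L) ⊓ unitaryGroupOfForm (conjMixed (↥(maximalRealSubfield L)) L (IsCMField.complexConj L)) 1) ≤ UnitaryGroup.arch (↥(maximalRealSubfield L)) L (IsCMField.complexConj L) 3 ((StdForm.antidiagonal 3).over L))) k))) ∪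
            ((finAdelicToAdelic (↥(maximalRealSubfield L)) L (IsCMField.complexConj L) 3 ((StdForm.antidiagonal 3).over L)) '' ((Kf.1 : Subgroup ↥(finAdelic (↥(maximalRealSubfield L)) L (IsCMField.complexConj L) 3 ((StdForm.antidiagonal 3).over L))) : Set ↥(finAdelic (↥(maximalRealSubfield L)) L (IsCMField.complexConj L) 3 ((StdForm.antidiagonal 3).over L)))))) ω χ₁ χ₂ ⊓ A'ᗮ)ᗮ) :
    ∀ W : ClosedSubrep ((quasiSplit (↥(maximalRealSubfield L)) L (IsCMField.complexConj L) 3).rightRegular μ), W.toContRep.IsTopIrreducible → W ≤ residualSubspace (quasiSplit (↥(maximalRealSubfield L)) L (IsCMField.complexConj L) 3) μ 𝔓 →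
      W.toSubmodule ⊓ ((⨅ u : ↥(Kf.1), Module.End.eigenspace ((((quasiSplit (↥(maximalRealSubfield L)) L (IsCMField.complexConj L) 3).rightRegular μ) (finAdelicToAdelic (↥(maximalRealSubfield L)) L (IsCMField.complexConj L) 3 ((StdForm.antidiagonal 3).over L) (u : ↥(finAdelic (↥(maximalRealSubfield L)) L (IsCMField.complexConj L) 3 ((StdForm.antidiagonal 3).over L)))) :
        (quasiSplit (↥(maximalRealSubfield L)) L (IsCMField.complexConj L) 3).L2 μ →L[ℂ] (quasiSplit (↥(maximalRealSubfield L)) L (IsCMField.complexConj L) 3).L2 μ) : (quasiSplit (↥(maximalRealSubfield L)) L (IsCMField.complexConj L) 3).L2 μ →ₗ[ℂ] (quasiSplit (↥(maximalRealSubfield L)) L (IsCMField.complexConj L) 3).L2 μ) 1) ⊓ ((((quasiSplit (↥(maximalRealSubfield L)) L (IsCMField.complexConj L) 3).rightRegular μ).restrict ((archToAdelic (↥(maximalRealSubfield L)) L (IsCMField.complexConj L) 3 ((StdForm.antidiagonal 3).over L)).comp (Subgroup.inclusion (inf_le_left : (UnitaryGroup.arch (↥(maximalRealSubfield L)) L (IsCMField.complexConj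 L) 3 ((StdForm.antidiagonal 3).over L) ⊓ unitaryGroupOfForm (conjMixed (↥(maximalRealSubfield L)) L (IsCMField.complexConj L)) 1) ≤ UnitaryGroup.arch (↥(maximalRealSubfield L)) L (IsCMField.complexConj L) 3 ((StdForm.antidiagonal 3).over L))))).isotypicComponent τ.1.toContRep).toSubmodule) ≤ (resGBlock L μ (Kf.1.map (finAdelicToAdelic (↥(maximalRealSubfield L)) L (IsCMField.complexConj L) 3 ((StdForm.antidiagonal 3).over L))) 1 χ₁ χ₂ ⊓ Aᗮ)ᗮ :=
  hτ_of_archLevel L μ 𝔓 Kf χ₁ hχ₂ τ _ ω A A' hA'A hAstab (fixFin_inf_le_fix_kad L μ Kf.1 χinf _ hτχ ω hωinf hω1) hcut h5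

end Record

end Summit.HodgeConjecture.HodgeConjecture.R90.S8

end
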